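import Literature.NumberTheory.PAdicHodge.AinfRamifiedFontaineLimit
import Literature.NumberTheory.PAdicHodge.AinfRamifiedFormalGroupPoints
import Literature.NumberTheory.PAdicHodge.AinfPSeriesContracting
import HarnessLib

/-!
# A series `P = p·f + g(X^p)` acts contractingly on `𝔫_𝒪 ⊂ A_inf(𝒪) = 𝔸_inf(F)[ϖ]`

Topic `Literature/NumberTheory/PAdicHodge`; the ramified twin of `AinfPSeriesContracting` (case `𝒪 = ℤ_p`), sequel of
`AinfRamifiedFontaineLimit` and `AinfRamifiedFormalGroupPoints`. For an ARBITRARY constant-term-free power series `P`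
over a discrete coefficient ring `A → A_inf(𝒪)` (e.g. `𝒪_D = ℤ_p[ϖ]`) admitting a decomposition `P = p·f + g(X^p)`
(`f`, `g` constant-term-free; Silverman AEC IV.4.4 for `P = [p]_𝔉`), evaluation `a ↦ P(a)` on the nil ideal
`𝔫_𝒪 = θ_𝒪⁻¹(𝔪_{ℂ_F})` is **contracting** for the `(p, ω)`-adic filtration (`AinfRamTop.IsContracting`):

  `a ≡ b (mod (p,ω)^{n+1}) ⇒ P(a) ≡ P(b) (mod (p,ω)^{n+2})`      (`isContracting_evalPt₁_of_decomp`),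

verbatim as over `𝔸_inf(F)`: `p ∈ (p, ω)`, the congruence lemma (tree `AinfRamTop.evalPt_sub_evalPt_mem`) and
`a^p ≡ b^p` one level up (tree `pow_sub_pow_mem_pow_succ`). Hence Fontaine's limit `[u] = lim Pⁿ(ûₙ)` (tree
`AinfRamTop.flim`) exists for every `P`-compatible sequence of points of `𝔪_{ℂ_F}` — the `p`-adic period lift of a
formal group over the RAMIFIED base `𝒪` once `P = [p]_𝔉`.

Main results: `AinfRamTop.coe_evalPt₁_decomp`, `AinfRamTop.isContracting_evalPt₁_of_decomp`. One auxiliary definition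
(`AinfRamTop.powPt`); no named facts, no `sorry`. Nothing about elliptic curves is proved here.

## References
* J. H. Silverman, *The Arithmetic of Elliptic Curves* (2009), IV.4.4 (`[p](T) = p f(T) + g(T^p)`). [SilvermanAEC2009]
* J.-M. Fontaine, *Le corps des périodes p-adiques*, Astérisque 223 (1994), Exp. II §1.2.1. [FontaineAsterisque223III]
* J.-P. Serre, *Local class field theory* (Cassels–Fröhlich Ch. VI) §3.2. [CasselsFrohlichANT1967]
-/

noncomputable section

open Ideal Filter Field WittVector MvPowerSeries ValuativeRel

namespace Literature.NumberTheory.PAdicHodge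

open Literature.NumberTheory.GaloisRepresentations
open Literature.NumberTheory.GaloisRepresentations.IsNonarchimedeanLocalField
open Literature.NumberTheory.GaloisRepresentations.LubinTate

namespace AinfRamTop

variable {F : Type} [Field F] [ValuativeRel F] [TopologicalSpace F] [IsNonarchimedeanLocalField F] [CharZero F]
  {p : ℕ} [Fact p.Prime] [Fact (¬ IsUnit (p : integerC F))]
  [IsAdicComplete (Ideal.span {(p : integerC F)}) (integerC F)] {hp : valuation F p < 1} {D : EisensteinRoot F p hp}
  {hθ : Function.Surjective (fontaineTheta (integerC F) p)}
  {A : Type*} [CommRing A] [UniformSpace A] [DiscreteUniformity A]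
  [Algebra A (AinfRamTop D)] [ContinuousSMul A (AinfRamTop D)]

omit [IsAdicComplete (Ideal.span {(p : integerC F)}) (integerC F)] in
/-- `a^p ≡ b^p (mod (p,ω)^{n+2})` if `a ≡ b (mod (p,ω)^{n+1})`. [cite: SilvermanAEC2009, IV.4.4] -/
theorem pow_prime_sub_pow_prime_mem {n : ℕ} {a b : AinfRamTop D}
    (h : a - b ∈ (WithIdeal.i ^ (n + 1) : Ideal (AinfRamTop D))) :
    a ^ p - b ^ p ∈ (WithIdeal.i ^ (n + 2) : Ideal (AinfRamTop D)) :=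
  pow_sub_pow_mem_pow_succ (Fact.out : p.Prime).pos (natCast_mem_ideal D) h

/-- The `p`-th power of a point of `𝔫`, as a point of `𝔫`. [folklore] -/
def powPt (a : (nilTheta D hθ).toIdeal) : (nilTheta D hθ).toIdeal :=
  ⟨(a : AinfRamTop D) ^ p, Ideal.pow_mem_of_mem _ a.2 _ (Fact.out : p.Prime).pos⟩

/-- Unfolding `powPt`. [cite: CasselsFrohlichANT1967, Ch. VI §3.2] -/
@[simp] theorem coe_powPt (a : (nilTheta D hθ).toIdeal) : (powPt a : AinfRamTop D) = (a : AinfRamTop D) ^ p := rfl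

/-- Evaluating `X^p` at a point `a` of `𝔫` gives `a^p`. [cite: CasselsFrohlichANT1967, Ch. VI §3.2] -/
theorem evalPt_X_pow (a : (nilTheta D hθ).toIdeal) :
    evalPt (nilTheta D hθ) (PowerSeries.X ^ p : PowerSeries A) AinfTop.constantCoeff_X_pow (fun _ : Unit => a) = powPt a := by
  apply Subtype.ext
  rw [coe_evalPt, map_pow, coe_powPt]
  congr 1
  exact aeval_X' ((nilTheta D hθ).hasEval fun _ : Unit => a) ()

/-- **`P(a) = p·f(a) + g(a^p)` on points**, for `P = p·f + g(X^p)`. [cite: SilvermanAEC2009, IV.4.4] -/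
theorem coe_evalPt₁_decomp {P f g : PowerSeries A} (hP0 : PowerSeries.constantCoeff P = 0)
    (hf0 : PowerSeries.constantCoeff f = 0) (hg0 : PowerSeries.constantCoeff g = 0)
    (hP : P = (p : PowerSeries A) * f + PowerSeries.subst (PowerSeries.X ^ p : PowerSeries A) g)
    (a : (nilTheta D hθ).toIdeal) :
    (evalPt₁ (nilTheta D hθ) P hP0 a : AinfRamTop D) =
      (p : AinfRamTop D) * evalPt₁ (nilTheta D hθ) f hf0 a + evalPt₁ (nilTheta D hθ) g hg0 (powPt a) := by
  have hsub0 : MvPowerSeries.constantCoeff (PowerSeries.subst (PowerSeries.X ^ p : PowerSeries A) g) = 0 :=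
    constantCoeff_subst_zero (σ := Unit) (a := fun _ => (PowerSeries.X ^ p : PowerSeries A))
      (fun _ => AinfTop.constantCoeff_X_pow) hg0
  have h1 : (evalPt₁ (nilTheta D hθ) P hP0 a : AinfRamTop D) =
      (p : AinfRamTop D) * evalPt₁ (nilTheta D hθ) f hf0 a +
        (evalPt (nilTheta D hθ) (PowerSeries.subst (PowerSeries.X ^ p : PowerSeries A) g) hsub0 (fun _ : Unit => a) :
          AinfRamTop D) := by
    rw [coe_evalPt₁, coe_evalPt₁, coe_evalPt, hP, map_add, map_mul, map_natCast]
    rfl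
  rw [h1, evalPt₁_subst (nilTheta D hθ) (PowerSeries.X ^ p : PowerSeries A) AinfTop.constantCoeff_X_pow g hg0 hsub0,
    evalPt_X_pow]

/-- **Silverman's decomposition makes `P` contracting**: if `P = p·f + g(X^p)` with `f`, `g` constant-term-free,
then `a ≡ b (mod (p,ω)^{n+1}) ⇒ P(a) ≡ P(b) (mod (p,ω)^{n+2})` on `𝔫` — the hypothesis `IsContracting` of
Fontaine's limit (tree `AinfTop.flim`). [cite: SilvermanAEC2009, IV.4.4] [cite: FontaineAsterisque223III, Exp. II §1.2.1] -/
theorem isContracting_evalPt₁_of_decomp {P f g : PowerSeries A} (hP0 : PowerSeries.constantCoeff P = 0)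
    (hf0 : PowerSeries.constantCoeff f = 0) (hg0 : PowerSeries.constantCoeff g = 0)
    (hP : P = (p : PowerSeries A) * f + PowerSeries.subst (PowerSeries.X ^ p : PowerSeries A) g) :
    IsContracting hθ (evalPt₁ (nilTheta D hθ) P hP0) := by
  intro n a b hab
  rw [coe_evalPt₁_decomp hP0 hf0 hg0 hP, coe_evalPt₁_decomp hP0 hf0 hg0 hP]
  have hf : (evalPt₁ (nilTheta D hθ) f hf0 a : AinfRamTop D) - evalPt₁ (nilTheta D hθ) f hf0 b ∈
      (WithIdeal.i ^ (n + 1) : Ideal (AinfRamTop D)) :=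
    evalPt_sub_evalPt_mem (isClosed_of_pow_le le_rfl) _ _ (fun _ : Unit => a) (fun _ : Unit => b) fun _ => hab
  have hg : (evalPt₁ (nilTheta D hθ) g hg0 (powPt a) : AinfRamTop D) - evalPt₁ (nilTheta D hθ) g hg0 (powPt b) ∈
      (WithIdeal.i ^ (n + 2) : Ideal (AinfRamTop D)) :=
    evalPt_sub_evalPt_mem (isClosed_of_pow_le le_rfl) _ _ (fun _ : Unit => powPt a) (fun _ : Unit => powPt b)
      fun _ => by rw [coe_powPt, coe_powPt]; exact pow_prime_sub_pow_prime_mem hab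
  have hpf : (p : AinfRamTop D) * ((evalPt₁ (nilTheta D hθ) f hf0 a : AinfRamTop D) - evalPt₁ (nilTheta D hθ) f hf0 b) ∈
      (WithIdeal.i ^ (n + 2) : Ideal (AinfRamTop D)) := by
    rw [show n + 2 = 1 + (n + 1) by ring, pow_add, pow_one]
    exact Ideal.mul_mem_mul (natCast_mem_ideal D) hf
  have : (p : AinfRamTop D) * (evalPt₁ (nilTheta D hθ) f hf0 a : AinfRamTop D) + evalPt₁ (nilTheta D hθ) g hg0 (powPt a) -
      ((p : AinfRamTop D) * evalPt₁ (nilTheta D hθ) f hf0 b + evalPt₁ (nilTheta D hθ) g hg0 (powPt b)) =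
      (p : AinfRamTop D) * ((evalPt₁ (nilTheta D hθ) f hf0 a : AinfRamTop D) - evalPt₁ (nilTheta D hθ) f hf0 b) +
        ((evalPt₁ (nilTheta D hθ) g hg0 (powPt a) : AinfRamTop D) - evalPt₁ (nilTheta D hθ) g hg0 (powPt b)) := by ring
  rw [this]
  exact Submodule.add_mem _ hpf hg

end AinfRamTop

end Literature.NumberTheory.PAdicHodge

end
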